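import Summits.BirchSwinnertonDyer.BirchSwinnertonDyer.Theses.SignedLowerHalves
import Summits.BirchSwinnertonDyer.BirchSwinnertonDyer.Theorems.SignedLowerHalvesKobayashiLowerHalfLargeImageDeepPoint
import HarnessLib

/-!
# Crux 3 `KobayashiLowerHalfLargeImage` (item stmt-BirchSwinnertonDyer-19001) BY NAME ⟺ its
# ONE-DEEP-POINT form (lead `bsd-line-slh-p1` gen 10; `--supports 19001 --as helper`; closes nothing)

CALIBRATION ONLY (pen rule D34-4 (3): never an input to a skeleton stub, to `closes`, or to a by-name
close of 19001). Imports the route file for the crux's name and the route-independent squeeze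
`Theorems/…LargeImageDeepPoint.lean`.

WHAT. Granted BY NAME the four published conjuncts of `PublishedSignedInputs` used by the squeeze —
Kobayashi 2003 Thm. 1.2 (`h12`), Thm. 4.1 (`h41`), and the period-unit facts
`realPeriodRat_eq_unit_mul_plusPeriod` (`h5`) / `…_three` (`h3`) —, the crux
`KobayashiLowerHalfLargeImage` (for every X7 pair at an odd `p` with `¬CM`, `a_p = 0`, `ρ̄_{E,p}` onto:
`∃ ε, KobayashiLowerDivisibility W p ε`) is EQUIVALENT to the class-wide ONE-DEEP-POINT statement: at
every such pair, for some sign `ε`, every admissible `(κ, γ, f, ϖ, (L⁺,L⁻), D)` admits `n ≥ 1` with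
`Φ_n ∤ L^ε_p` and `g, h, c ∈ Λ` with `char X^ε = (g)`, `ι(g + Φ_n·c) = ϖ·ι(L^ε_p·h)` — the body of the
line predicate `RohrlichSqueeze.DeepPointLowerDivisibility W p ε` of
`Cruxes/KobayashiLowerHalfLargeImage/Lines/rohrlich_squeeze.lean` (k1 g9), VERBATIM up to `cycPhi = rfl`
(`kobayashiLowerHalfLargeImage_iff_deepPoint`). The direction crux ⟹ deep point is UNCONDITIONAL
(`deepPoint_of_kobayashiLowerHalfLargeImage`); the direction deep point ⟹ crux
(`kobayashiLowerHalfLargeImage_of_deepPoint`) holds at EVERY odd `p` — the line's separate `p = 3` stub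
is not needed by the squeeze (Kato's integrality on X7∧surj(3) is the tree theorem
`surjective_pow_of_surj_of_good`).

READING (honest). This RELOCATES the crux; it does not shrink it: the one-deep-point statement is the
Eisenstein (non-Kato) divisibility at one height-one prime `(Φ_n)` of `Λ`, i.e. — by Kobayashi's control
theorem, B. D. Kim's no-finite-submodule theorem and Pollack's interpolation, none of which is invoked
here — a lower bound for the new part of `Sel_{p^∞}(E/ℚ_n)` by the `χ`-twisted `L`-values of conductor
`p^{n+1}`, open in print on X7 exactly as the crux is. What the kernel now records is that ANY single
layer `n ≥ 1` of either parity and EITHER sign suffices, at every odd `p` including `3`.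
No summit statement is proved by this file; BSD is not proved by any of this.

References: [Kobayashi2003] Thm. 1.2, Thm. 4.1, Conjecture (p. 2); [Pollack2003] Cor. 5.11;
[Washington1997] Prop. 7.2, §7.1; [GreenbergVatsal2000] §3 Rem. 3.4; [Wuthrich2014] Lemma 20.
-/

set_option autoImplicit false
-- single-problem summit (D-0017): the doubled namespace component `BirchSwinnertonDyer` is by design
set_option linter.dupNamespace false

noncomputable section

open scoped Classical MatrixGroups ModularForm

open CongruenceSubgroup Polynomial WeierstrassCurve Literature.NumberTheory.EllipticCurves
  Literature.NumberTheory.EllipticCurves.ModularForms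
  Literature.NumberTheory.EllipticCurves.Rank1Residual
  Literature.NumberTheory.EllipticCurves.Kobayashi2003 ZpExtension
  Summit.BirchSwinnertonDyer.Rank1Residual.Supersingular
  Summit.BirchSwinnertonDyer.BirchSwinnertonDyer.Theorems
  Summit.BirchSwinnertonDyer.BirchSwinnertonDyer.Theses.SignedLowerHalves

namespace Summit.BirchSwinnertonDyer.BirchSwinnertonDyer.Theorems.LargeImageDeepPointCrux

/-- **Crux 3 ⟸ the class-wide one-deep-point statement, every odd `p`** (granted `h12`, `h41`, `h5`,
`h3` BY NAME). The hypothesis `hA` is, pair by pair, `∃ ε, RohrlichSqueeze.DeepPointLowerDivisibility W p ε`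
with its body written out; the conclusion is the route decl `KobayashiLowerHalfLargeImage` BY NAME.
[cite: Kobayashi2003, Thm. 1.2, Thm. 4.1 and Conjecture (p. 2)] [cite: Washington1997, Prop. 7.2, §7.1]
[cite: GreenbergVatsal2000, §3 Remark 3.4] [cite: Wuthrich2014, Lemma 20 (p. 399)] -/
theorem kobayashiLowerHalfLargeImage_of_deepPoint (h12 : thm12_signedSelmerDual_finite_torsion)
    (h41 : thm41_signedCharIdeal_divisibility) (h5 : realPeriodRat_eq_unit_mul_plusPeriod)
    (h3 : realPeriodRat_eq_unit_mul_plusPeriod_three)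
    (hA : ∀ (W : WeierstrassCurve ℚ) [W.IsElliptic] [W.IsGloballyMinimal] (p : ℕ) [Fact p.Prime],
      p ≠ 2 → ClassX7 W p → ¬ W.HasCM → W.frobeniusTrace p = 0 → Surj W p → ∃ ε : ℤˣ,
      ∀ (κ : ZpExtension ℚ p) (γ : Field.absoluteGaloisGroup ℚ),
        κ.IsCyclotomic → κ.IsTopGenerator γ → IsCyclotomicVariable p γ →
      ∀ [NeZero (W.conductorNorm ℤ)] (f : CuspForm (Gamma0 (W.conductorNorm ℤ)) 2),
        IsNewformOf W f → ∀ (ϖ : ℚ), (ϖ : ℝ) * W.realPeriodRat = plusPeriod f →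
      ∀ (Lplus Lminus : IwasawaAlgebra p), IsPollackPair f p Lplus Lminus →
      ∀ (D : SignedSelmerDualData W κ γ ε),
        ∃ n : ℕ, 1 ≤ n ∧ ¬ (((((cyclotomic (p ^ n) ℤ).comp (X + 1)).map (Int.castRingHom ℤ_[p]) :
          ℤ_[p][X]) : PowerSeries ℤ_[p]) ∣ kobayashiL ε Lplus Lminus) ∧
          ∃ g h c : IwasawaAlgebra p, D.charIdeal = Ideal.span {g} ∧
            iwasawaToPowerSeries p (g + ((((cyclotomic (p ^ n) ℤ).comp (X + 1)).map
              (Int.castRingHom ℤ_[p]) : ℤ_[p][X]) : PowerSeries ℤ_[p]) * c) =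
              PowerSeries.C (ϖ : ℚ_[p]) * iwasawaToPowerSeries p (kobayashiL ε Lplus Lminus * h)) :
    KobayashiLowerHalfLargeImage := by
  intro W _ _ p _ hp2 hX hcm hap hs
  obtain ⟨ε, hC⟩ := hA W p hp2 hX hcm hap hs
  exact ⟨ε, LargeImageDeepPoint.kobayashiLowerDivisibility_of_deepPoint_of_classX7 W p h12 h41 h5 h3
    hp2 hX hap hs ε hC⟩

/-- **Crux 3 ⟹ the class-wide one-deep-point statement (UNCONDITIONAL)**: with the crux's own sign
`ε`, `c = 0` at the deep point `n = λ(L^ε_p) + 1`. [cite: Kobayashi2003, Conjecture (p. 2)]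
[cite: Pollack2003, Cor. 5.11] [cite: Washington1997, §7.1] -/
theorem deepPoint_of_kobayashiLowerHalfLargeImage (hK : KobayashiLowerHalfLargeImage) :
    ∀ (W : WeierstrassCurve ℚ) [W.IsElliptic] [W.IsGloballyMinimal] (p : ℕ) [Fact p.Prime],
      p ≠ 2 → ClassX7 W p → ¬ W.HasCM → W.frobeniusTrace p = 0 → Surj W p → ∃ ε : ℤˣ,
      ∀ (κ : ZpExtension ℚ p) (γ : Field.absoluteGaloisGroup ℚ),
        κ.IsCyclotomic → κ.IsTopGenerator γ → IsCyclotomicVariable p γ →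
      ∀ [NeZero (W.conductorNorm ℤ)] (f : CuspForm (Gamma0 (W.conductorNorm ℤ)) 2),
        IsNewformOf W f → ∀ (ϖ : ℚ), (ϖ : ℝ) * W.realPeriodRat = plusPeriod f →
      ∀ (Lplus Lminus : IwasawaAlgebra p), IsPollackPair f p Lplus Lminus →
      ∀ (D : SignedSelmerDualData W κ γ ε),
        ∃ n : ℕ, 1 ≤ n ∧ ¬ (((((cyclotomic (p ^ n) ℤ).comp (X + 1)).map (Int.castRingHom ℤ_[p]) :
          ℤ_[p][X]) : PowerSeries ℤ_[p]) ∣ kobayashiL ε Lplus Lminus) ∧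
          ∃ g h c : IwasawaAlgebra p, D.charIdeal = Ideal.span {g} ∧
            iwasawaToPowerSeries p (g + ((((cyclotomic (p ^ n) ℤ).comp (X + 1)).map
              (Int.castRingHom ℤ_[p]) : ℤ_[p][X]) : PowerSeries ℤ_[p]) * c) =
              PowerSeries.C (ϖ : ℚ_[p]) * iwasawaToPowerSeries p (kobayashiL ε Lplus Lminus * h) := by
  intro W _ _ p _ hp2 hX hcm hap hs
  obtain ⟨ε, hε⟩ := hK W p hp2 hX hcm hap hs
  exact ⟨ε, LargeImageDeepPoint.deepPoint_of_kobayashiLowerDivisibility W p hε⟩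

/-- **EQUIVALENCE (calibration): crux 3 `KobayashiLowerHalfLargeImage` ⟺ its class-wide ONE-DEEP-POINT
form**, granted `h12`, `h41`, `h5`, `h3` BY NAME. Never an input to a stub / `closes` / by-name close of
item 19001 (it would be circular); a record of WHERE the crux may be attacked: one height-one prime
`(Φ_n)` of `Λ`, any `n ≥ 1`, either sign, every odd `p`.
[cite: Kobayashi2003, Thm. 1.2, Thm. 4.1 and Conjecture (p. 2)] [cite: Washington1997, Prop. 7.2, §7.1]
[cite: GreenbergVatsal2000, §3 Remark 3.4] [cite: Pollack2003, Cor. 5.11] -/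
theorem kobayashiLowerHalfLargeImage_iff_deepPoint (h12 : thm12_signedSelmerDual_finite_torsion)
    (h41 : thm41_signedCharIdeal_divisibility) (h5 : realPeriodRat_eq_unit_mul_plusPeriod)
    (h3 : realPeriodRat_eq_unit_mul_plusPeriod_three) :
    KobayashiLowerHalfLargeImage ↔
    ∀ (W : WeierstrassCurve ℚ) [W.IsElliptic] [W.IsGloballyMinimal] (p : ℕ) [Fact p.Prime],
      p ≠ 2 → ClassX7 W p → ¬ W.HasCM → W.frobeniusTrace p = 0 → Surj W p → ∃ ε : ℤˣ,
      ∀ (κ : ZpExtension ℚ p) (γ : Field.absoluteGaloisGroup ℚ),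
        κ.IsCyclotomic → κ.IsTopGenerator γ → IsCyclotomicVariable p γ →
      ∀ [NeZero (W.conductorNorm ℤ)] (f : CuspForm (Gamma0 (W.conductorNorm ℤ)) 2),
        IsNewformOf W f → ∀ (ϖ : ℚ), (ϖ : ℝ) * W.realPeriodRat = plusPeriod f →
      ∀ (Lplus Lminus : IwasawaAlgebra p), IsPollackPair f p Lplus Lminus →
      ∀ (D : SignedSelmerDualData W κ γ ε),
        ∃ n : ℕ, 1 ≤ n ∧ ¬ (((((cyclotomic (p ^ n) ℤ).comp (X + 1)).map (Int.castRingHom ℤ_[p]) :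
          ℤ_[p][X]) : PowerSeries ℤ_[p]) ∣ kobayashiL ε Lplus Lminus) ∧
          ∃ g h c : IwasawaAlgebra p, D.charIdeal = Ideal.span {g} ∧
            iwasawaToPowerSeries p (g + ((((cyclotomic (p ^ n) ℤ).comp (X + 1)).map
              (Int.castRingHom ℤ_[p]) : ℤ_[p][X]) : PowerSeries ℤ_[p]) * c) =
              PowerSeries.C (ϖ : ℚ_[p]) * iwasawaToPowerSeries p (kobayashiL ε Lplus Lminus * h) :=
  ⟨deepPoint_of_kobayashiLowerHalfLargeImage, kobayashiLowerHalfLargeImage_of_deepPoint h12 h41 h5 h3⟩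

end Summit.BirchSwinnertonDyer.BirchSwinnertonDyer.Theorems.LargeImageDeepPointCrux

end
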